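import Literature.NumberTheory.QuadraticForms.HilbertSymbolRegularLocal
import Mathlib.LinearAlgebra.QuadraticForm.Basic
import HarnessLib

/-!
# No quadratic form on a space of dimension `≥ 5` over `K_v` is anisotropic (u-invariant `≤ 4`, basis-free form)

Topic `NumberTheory/QuadraticForms`; namespace `Literature.NumberTheory.QuadraticForms`. Everything here is
proved; it is the coordinate-free (`QuadraticForm` on an abstract module) repackaging of the matrix theorem
`exists_isotropic_of_five_le` ∕ `exists_isotropic_of_five_le_adicCompletion` (`IsotropicRankFive.lean`,
`HilbertSymbolRegularLocal.lean`: Serre, *A Course in Arithmetic*, Ch. IV §2.2 Thm 6 (iv) for arbitrary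
nondegenerate symmetric matrices), INCLUDING degenerate forms:

* `not_anisotropic_of_five_le_finrank` — over a field `F` with bilinear nondegenerate Hilbert symbol
  (`IsRegularHilbertField F`) and three non-squares `b, c, bc`, a quadratic form `Q` on an `F`-space `M` with
  `5 ≤ finrank F M` has a non-trivial zero.  Proof: take an orthogonal basis `b` for the associated bilinear form
  `B = Q.associated` (Mathlib `LinearMap.BilinForm.exists_orthogonal_basis`, `2` invertible); if one of the first
  five `Q (bᵢ) = B bᵢ bᵢ` vanishes, `bᵢ ≠ 0` is a zero; otherwise the diagonal quinary form `∑_{i<5} Q(bᵢ) Xᵢ²`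
  has a non-trivial zero `x` (`exists_isotropic_of_rank_five`) and `∑ xᵢ bᵢ ≠ 0` is a zero of `Q`.
* `not_anisotropic_of_five_le_finrank_adicCompletion` — the case `F = K_v`, the completion of a number field `K`
  at a finite place `v` (`isRegularHilbertField_adicCompletion`, `exists_three_nonsquares_adicCompletion`), i.e.
  **the u-invariant of `K_v` is at most `4`** [Lam2005, Ch. VI Thm 2.12] (Serre states it for `ℚ_p`).

## References

* T. Y. Lam, *Introduction to quadratic forms over fields*, GSM 67, AMS 2005, Ch. VI Thm 2.12. [Lam2005]
* J.-P. Serre, *A Course in Arithmetic*, GTM 7, Springer 1973, Ch. IV §2.2 Thm 6 (iv). [Serre1973]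
-/

namespace Literature.NumberTheory.QuadraticForms

open Finset IsDedekindDomain NumberField

variable {F : Type*} [Field F]

/-- **No quadratic form in `≥ 5` variables over a field with regular Hilbert symbol and four square classes is
anisotropic** (Serre, *A Course in Arithmetic*, Ch. IV §2.2 Thm 6 (iv), basis-free and including degenerate forms):
for `Q : QuadraticForm F M` with `5 ≤ finrank F M` there is `x ≠ 0` with `Q x = 0`.  Orthogonal basis of
`Q.associated`; a basis vector with `Q bᵢ = 0` is a zero, else `exists_isotropic_of_rank_five` on the first five
diagonal coefficients. [cite: Serre1973, Ch. IV §2.2 Thm 6 (iv)] -/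
theorem not_anisotropic_of_five_le_finrank (hF : IsRegularHilbertField F)
    (hC : ∃ b c : F, ¬ IsSquare b ∧ ¬ IsSquare c ∧ ¬ IsSquare (b * c))
    {M : Type*} [AddCommGroup M] [Module F M] (Q : QuadraticForm F M) (hM : 5 ≤ Module.finrank F M) :
    ¬ Q.Anisotropic := by
  classical
  intro hQ
  haveI : Module.Finite F M := Module.finite_of_finrank_pos (by omega)
  haveI : Invertible (2 : F) := invertibleOfNonzero hF.two_ne_zero
  set B : LinearMap.BilinForm F M := QuadraticMap.associated Q with hB
  have hBs : LinearMap.IsSymm B := QuadraticForm.associated_isSymm F Q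
  obtain ⟨b, hb⟩ := LinearMap.BilinForm.exists_orthogonal_basis hBs
  have hb' : LinearMap.BilinForm.iIsOrtho B b := hb
  have hBQ : ∀ x, B x x = Q x := fun x => QuadraticMap.associated_eq_self_apply F Q x
  -- the first five basis vectors and their values
  let e : Fin 5 → Fin (Module.finrank F M) := Fin.castLE hM
  have he : Function.Injective e := Fin.castLE_injective _
  set a : Fin 5 → F := fun i => Q (b (e i)) with ha
  by_cases ha0 : ∀ i, a i ≠ 0
  · obtain ⟨x, hx0, hx⟩ := exists_isotropic_of_rank_five hF hC ha0
    refine hx0 ?_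
    have hzero : Q (∑ i, x i • b (e i)) = 0 := by
      rw [← hBQ, LinearMap.BilinForm.sum_left, ← hx]
      refine Finset.sum_congr rfl fun i _ => ?_
      rw [LinearMap.BilinForm.sum_right, Finset.sum_eq_single i]
      · rw [LinearMap.BilinForm.smul_left, LinearMap.BilinForm.smul_right, hBQ]
        simp only [ha]
        ring
      · intro j _ hji
        rw [LinearMap.BilinForm.smul_left, LinearMap.BilinForm.smul_right]
        have : B (b (e i)) (b (e j)) = 0 :=
          LinearMap.BilinForm.iIsOrtho_def.mp hb' _ _ (fun h => hji (he h).symm)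
        rw [this, mul_zero, mul_zero]
      · intro hi
        exact absurd (Finset.mem_univ i) hi
    have h0 := hQ _ hzero
    -- linear independence of `b ∘ e`
    have hli : LinearIndependent F (b ∘ e) := b.linearIndependent.comp e he
    funext i
    exact Fintype.linearIndependent_iff.mp hli x h0 i
  · push Not at ha0
    obtain ⟨i, hi⟩ := ha0
    exact b.ne_zero (e i) (hQ _ hi)

/-- **The u-invariant of `K_v` is at most `4`, basis-free form** (Lam, Ch. VI Thm 2.12; Serre, Ch. IV §2.2 Thm 6 (iv)
for `ℚ_p`): over the completion `K_v` of a number field `K` at a finite place `v`, NO quadratic form on a `K_v`-space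
of dimension `≥ 5` is anisotropic — degenerate forms included.  `not_anisotropic_of_five_le_finrank` for the regular
Hilbert field `K_v` (`isRegularHilbertField_adicCompletion`, `exists_three_nonsquares_adicCompletion`).
[cite: Lam2005, Ch. VI Thm 2.12] -/
theorem not_anisotropic_of_five_le_finrank_adicCompletion (K : Type) [Field K] [NumberField K]
    (v : HeightOneSpectrum (𝓞 K)) {M : Type*} [AddCommGroup M] [Module (v.adicCompletion K) M]
    (Q : QuadraticForm (v.adicCompletion K) M) (hM : 5 ≤ Module.finrank (v.adicCompletion K) M) :
    ¬ Q.Anisotropic :=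
  not_anisotropic_of_five_le_finrank (isRegularHilbertField_adicCompletion K v)
    (exists_three_nonsquares_adicCompletion K v) Q hM

end Literature.NumberTheory.QuadraticForms
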